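import Mathlib.NumberTheory.LegendreSymbol.JacobiSymbol
import Mathlib.LinearAlgebra.Matrix.ToLinearEquiv
import HarnessLib

/-!
# LINE 49 «full_vertex» — route-posited vocabulary (Defs): the Rédei–Laplacian pair criterion

Crux R″ `RankOneTwoTorsionResidualAtTwo` (stmt-27478) of route GenusKolyvaginAtTwo, LINE 49 «full_vertex» (pen bsd-idea-1;
hosted at `Cruxes/MinimalTwinBSDTwo/Lines/torsion_cell_full_vertex_bsdidea1.lean`, v1.4.3).  This is the `…Defs` file the line
posits for its SUPPORT statement SEL `IsoClassSelmerPairLawAtTwo` (the exact iso-class Selmer pair law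
`#Sel⁽²⁾(E₀^{(M₀)}) = 4·#ker Φ₃(Ĝ)`, `#Sel⁽²⁾(E₀^{(−p₀M₀)}) = 8·#ker Φ₃(B)`): the COMBINATORIAL objects of the line's §1b, copied
VERBATIM (bodies byte-identical) from the Cruxes workfile — which `Theorems` files cannot import — so that kernel theorems about
the law can be stated and the line's stub closed by `exact` (definitional unfolding), exactly as was done for D0≤2
(`…TorsionCellD0Closer`).  Nothing is asserted here; no statement of the line (F0aJ′, F0bJ, SEL, …) is re-declared.

* `legendreBit a q` — the additive Legendre bit `[a/q] ∈ 𝔽₂`;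
* `redeiLaplacian Q₀` — the Rédei–Laplacian `Ĝ ∈ M_{Q₀}(𝔽₂)` of a finite set of primes (Laplacian of the tournament of
  symbols `[−qᵢ/qⱼ]`), `borderedLaplacian Q₀ p₀ = Ĝ + diag([−p₀/qⱼ])`;
* `phi3 A = A² + A + 1`;
* `LaplacianPairCriterion Q₀ p₀` — `det Φ₃(Ĝ) = 1 ∧ det Φ₃(B) = 1` (decidable);
* `IsIsoClass N Q₀` — all `q ∈ Q₀` share one square class at every `ℓ ∣ 2N` (same residue mod `8`, same `(−q/ℓ)`);
* two kernel-cardinality lemmas over `𝔽₂` (`card_ker_mulVecLin_eq_one_iff_det_eq_one`, `one_le_card_ker_mulVecLin`).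

## References

* [HeathBrown1994SelmerCongruentII] D. R. Heath-Brown, *The size of Selmer groups for the congruent number problem, II*,
  Invent. Math. 118 (1994) — Selmer ranks of twists as coranks of Legendre-symbol matrices over `𝔽₂`.
* [Kane2013SelmerTwists] D. M. Kane, *On the ranks of the 2-Selmer groups of twists of a given elliptic curve*, Algebra
  Number Theory 7 (2013) — the same matrices for a general full-2-torsion curve.
-/

namespace Summit.BirchSwinnertonDyer.BirchSwinnertonDyer.Theorems.GenusKolyvaginAtTwo.FullVertex

/-- Additive Legendre bit `[a/q] ∈ 𝔽₂` (`q` an odd prime, `q ∤ a`): `1` iff `(a/q) = −1`.  (LINE 49 §1b, verbatim.)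
[cite: HeathBrown1994SelmerCongruentII, §2] -/
def legendreBit (a : ℤ) (q : ℕ) : ZMod 2 := if jacobiSym a q = -1 then 1 else 0

/-- **RÉDEI–LAPLACIAN** `Ĝ` of a finite set `Q₀` of primes `≡ 3 (mod 4)` (`q* = −q`) over `𝔽₂`, indexed by `Q₀` itself: row `j`, column
`i ≠ j` ↦ `[qᵢ*/qⱼ] = [−qᵢ/qⱼ]`; diagonal `(j,j)` ↦ the sum of the other entries of ROW `j` (rows sum to `0`; by reciprocity between primes
`≡ 3 (mod 4)` the off-diagonal part is a TOURNAMENT, `Ĝ + Ĝᵀ = J − I` off the diagonal, and for `#Q₀` even the columns sum to `1`).  This is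
the Laplacian of the Rédei/Monsky symbol graph, NOT a class-group Rédei matrix.  (LINE 49 §1b, verbatim.)
[cite: HeathBrown1994SelmerCongruentII, §2] -/
def redeiLaplacian (Q₀ : Finset ℕ) : Matrix Q₀ Q₀ (ZMod 2) :=
  fun j i => if i = j then ∑ i' : Q₀, (if i' = j then 0 else legendreBit (-((i' : ℕ) : ℤ)) j)
    else legendreBit (-((i : ℕ) : ℤ)) j

/-- **BORDERED LAPLACIAN** `B = Ĝ + diag([−p₀/qⱼ])` (`[−p₀/qⱼ] = [qⱼ/p₀]` by reciprocity, `p₀ ≡ qⱼ ≡ 3 (mod 4)`).  (LINE 49 §1b, verbatim.)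
[cite: HeathBrown1994SelmerCongruentII, §2] -/
def borderedLaplacian (Q₀ : Finset ℕ) (p₀ : ℕ) : Matrix Q₀ Q₀ (ZMod 2) :=
  redeiLaplacian Q₀ + Matrix.diagonal fun j : Q₀ => legendreBit (-(p₀ : ℤ)) (j : ℕ)

/-- `Φ₃(A) = A² + A + 1` — the third cyclotomic polynomial at `A`; `det Φ₃(A) ≠ 0` over `𝔽₂` iff `A` has no eigenvalue in `𝔽₄ ∖ 𝔽₂`.
(LINE 49 §1b, verbatim.) [cite: HeathBrown1994SelmerCongruentII, §2] -/
def phi3 {n : Type*} [Fintype n] [DecidableEq n] (A : Matrix n n (ZMod 2)) : Matrix n n (ZMod 2) := A * A + A + 1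

/-- Over `𝔽₂` the kernel of a square matrix (as `mulVecLin`) is trivial iff its determinant is `1` — CARDINALITY form
(`Matrix.exists_mulVec_eq_zero_iff` + `Nat.card_eq_one_iff_unique`).  (LINE 49 §1b, verbatim.) [cite: HeathBrown1994SelmerCongruentII, §2] -/
theorem card_ker_mulVecLin_eq_one_iff_det_eq_one {n : Type*} [Fintype n] [DecidableEq n] (A : Matrix n n (ZMod 2)) :
    Nat.card (LinearMap.ker A.mulVecLin) = 1 ↔ A.det = 1 := by
  have hdet : A.det = 1 ↔ ¬ A.det = 0 := by generalize A.det = x; revert x; decide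
  rw [hdet, ← Matrix.exists_mulVec_eq_zero_iff, Nat.card_eq_one_iff_unique]
  constructor
  · rintro ⟨hs, -⟩ ⟨v, hv0, hv⟩
    have hmem : v ∈ LinearMap.ker A.mulVecLin := by simpa [LinearMap.mem_ker] using hv
    have h0 : (0 : n → ZMod 2) ∈ LinearMap.ker A.mulVecLin := by simp
    have := Subsingleton.elim (⟨v, hmem⟩ : LinearMap.ker A.mulVecLin) ⟨0, h0⟩
    exact hv0 (by simpa using congrArg Subtype.val this)
  · intro h
    refine ⟨⟨fun x y => ?_⟩, ⟨⟨0, by simp⟩⟩⟩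
    by_contra hxy
    apply h
    refine ⟨x.1 - y.1, ?_, ?_⟩
    · intro h0
      exact hxy (Subtype.ext (sub_eq_zero.mp h0))
    · have hx := x.2
      have hy := y.2
      rw [LinearMap.mem_ker, Matrix.mulVecLin_apply] at hx hy
      rw [Matrix.mulVec_sub, hx, hy, sub_zero]

/-- The kernel cardinality is positive (it is `2^{dim ker}`).  (LINE 49 §1b, verbatim.) [cite: HeathBrown1994SelmerCongruentII, §2] -/
theorem one_le_card_ker_mulVecLin {n : Type*} [Fintype n] [DecidableEq n] (A : Matrix n n (ZMod 2)) :
    1 ≤ Nat.card (LinearMap.ker A.mulVecLin) :=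
  Nat.one_le_iff_ne_zero.mpr (Nat.card_pos (α := LinearMap.ker A.mulVecLin)).ne'

/-- **THE ISO-CLASS LAPLACIAN PAIR CRITERION**: `det Φ₃(Ĝ) = 1 ∧ det Φ₃(Ĝ + diag[−p₀/q]) = 1` over `𝔽₂` — by the iso-class Selmer pair
law SEL the two twists `E₀^{(M₀)}`, `E₀^{(−p₀M₀)}` are Selmer-generic iff this holds; kernel-decidable.  (LINE 49 §1b, verbatim.)
[cite: HeathBrown1994SelmerCongruentII, §2] [cite: Kane2013SelmerTwists, §2] -/
def LaplacianPairCriterion (Q₀ : Finset ℕ) (p₀ : ℕ) : Prop :=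
  (phi3 (redeiLaplacian Q₀)).det = 1 ∧ (phi3 (borderedLaplacian Q₀ p₀)).det = 1

/-- **ISO-CLASS** set of primes relative to a level `N`: all `q ∈ Q₀` have the same residue mod `8` and the same `(−q/ℓ)` at every odd
prime `ℓ ∣ N` — i.e. the `−q` (`= q*` for full-admissible `q`, which are `≡ 3 (mod 4)`) share ONE square class in `ℚ_ℓ^×/ℚ_ℓ^{×2}` for
every `ℓ ∣ 2N`.  For `#Q₀` even this implies that every `ℓ ∣ 2N` splits in `ℚ(√∏ q*)`; it is the sub-family in which the relaxed
Selmer group `Sel^{Q₀}(E₀)` has the explicit basis `tors ⊕ (A × A)`, `A` = even sub-products, which is what makes the law base-free.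
(LINE 49 §1b, verbatim.) [cite: Kane2013SelmerTwists, §2] -/
def IsIsoClass (N : ℕ) (Q₀ : Finset ℕ) : Prop :=
  ∀ q ∈ Q₀, ∀ q' ∈ Q₀, q % 8 = q' % 8 ∧ ∀ ℓ ∈ N.primeFactors, ℓ ≠ 2 → jacobiSym (-(q : ℤ)) ℓ = jacobiSym (-(q' : ℤ)) ℓ

end Summit.BirchSwinnertonDyer.BirchSwinnertonDyer.Theorems.GenusKolyvaginAtTwo.FullVertex
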